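import Literature.NumberTheory.NumberFields.RayClassFieldAdicCharacter
import HarnessLib

/-!
# The `v`-adic Artin character on ARTIN SYMBOLS OF PRINCIPAL IDEALS: for `α ≡ 1 mod 𝔪`, `v ∤ α`,
# `((α), K(𝔪vⁿ)/K) = [⟨α_v⁻¹⟩_v, K]|_{K(𝔪vⁿ)}` for every `n`, hence `κ(σ_(α)) = α_v⁻¹`
# (de Shalit 1987, II.1.7 / II.4.12: the dictionary between the elliptic units' index set and `κ`; part 4)

Sequel of `RayClassFieldAdicArtinValue.lean` / `RayClassFieldAdicCharacter.lean`. The elliptic units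
of de Shalit II.2 / II.4 are indexed by integral IDEALS `𝔞` and Galois acts on them through ARTIN
SYMBOLS of ideals (`prop24_ii_galoisAction`: `artinSymbol (galFrob K (rayClassField K 𝔪)) 𝔠`), while the
measure side reads `Gal(K̄/K(𝔪))` through the `v`-adic character `κ = rayAdicCharacter` (I.3.3 (9)).
The division step II.4.12 uses `𝔞₁ = (α₁)` PRINCIPAL with `α₁ ≡ 1 mod 𝔣` and a prescribed
`𝔭`-adic distance of `α₁` to `1` ("`σ_𝔞` a topological generator of `Gal(K(𝔣𝔭^∞)/K(𝔣𝔭ˢ))`"). THIS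
FILE is the dictionary between the two currencies, for `K` totally complex, `𝔪 ≠ 0`, `v ∤ 𝔪`:

* §6 `integerUnit v α hα : 𝒪_vˣ` — an integer `α ∉ v` as a local unit at `v`;
  ★★ `abRestrict_ideleArtinMap_localUnits_integerUnit_inv` — for `α ≠ 0`, `α − 1 ∈ 𝔪`, `α ∉ v` and
  every `n`: **`[⟨α_v⁻¹⟩_v, K]|_{K(𝔪vⁿ)} = ((α), K(𝔪vⁿ)/K)`** (`artinHom (galFrob K _) (α)`): the idele
  `(α)·⟨α_v⁻¹⟩_v` is `≡ 1` at the primes of `𝔪vⁿ` and its ideal is `(α)` (Neukirch VI (1.9) «`( )`»);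
* ★★ `isAdicArtinValue_integerUnit_inv_of_forall` — any `σ ∈ Γ_K` restricting to `((α), K(𝔪vⁿ)/K)`
  on every `K(𝔪vⁿ)` (e.g. a lift of `[idealIdele (α), K]`, `exists_forall_absRestrictNormalHom_eq_artinHom`)
  lies in `Gal(K̄/K(𝔪))` and has `v`-adic Artin value `α_v⁻¹`, so (`w_𝔪 = 1`)
  ★★ `rayAdicCharacter_eq_integerUnit_inv` — **`κ(σ_(α)) = α_v⁻¹`**;
* `artinHom_span_singleton_rayClassField_mul_pow_eq_one_iff` — **`((α), K(𝔪vⁿ)/K) = 1 ↔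
  α − 1 ∈ vⁿ`** (for `α − 1 ∈ 𝔪`, `v ∤ α`, `w_𝔪 = 1`): the `v`-adic distance of `α` to `1` is the
  level of `σ_(α)` in the tower `K(𝔪vⁿ)` — the input "`σ_{𝔞₁}` generates `Gal(K(𝔣𝔭ⁿ)/K(𝔣𝔭ˢ))`" of
  the division step II.4.12 (at `p = 2` with `s ≥ 2`: the `1 + 4ℤ₂` clause of II.4.17) reduces to
  choosing `α₁` with `v(α₁ − 1) = s` exactly.

One small definition with body (`integerUnit`); theorems otherwise; no named facts, no instances, no
`sorry`.

## References

* [deShalit1987] E. de Shalit, *Iwasawa theory of elliptic curves with complex multiplication*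
  (1987), I.3.3 (9) (p. 18), II.1.7 (p. 41), II.2.4 (ii) (p. 44), II.4.12 (p. 66–68), II.4.17 (p. 78).
* [NeukirchANT1999] J. Neukirch, *Algebraic Number Theory* (1999), Ch. VI §1 Prop. (1.9), §7 Thm. (7.1).
-/

noncomputable section

open NumberField IsDedekindDomain IsDedekindDomain.HeightOneSpectrum Field
open scoped nonZeroDivisors Classical

namespace Literature.NumberTheory.NumberFields

open Literature.NumberTheory.GaloisRepresentations

variable {K : Type} [Field K] [NumberField K]

/-! ### §6. Integers as local units; the Artin symbol of `(α)` read through `⟨α_v⁻¹⟩_v` -/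

section Principal

variable {𝔪 : Ideal (𝓞 K)} (v : HeightOneSpectrum (𝓞 K))

/-- An integer `α ∉ v` has `|α|_v = 1` in `K_v`. [cite: NeukirchANT1999, Ch. II §3 Prop. (3.8)] -/
theorem valued_algebraMap_eq_one_of_not_mem {α : 𝓞 K} (hα : α ∉ v.asIdeal) :
    Valued.v (((α : K) : v.adicCompletion K)) = 1 := by
  rw [valuedAdicCompletion_eq_valuation', show (α : K) = algebraMap (𝓞 K) K α from rfl,
    valuation_of_algebraMap, intValuation_eq_one_iff]
  exact hα

/-- **An integer `α ∉ v` as a local unit `α_v ∈ 𝒪_vˣ`.** [cite: NeukirchANT1999, Ch. II §3 Prop. (3.8)] -/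
def integerUnit (α : 𝓞 K) (hα : α ∉ v.asIdeal) : (v.adicCompletionIntegers K)ˣ :=
  ((HeightOneSpectrum.adicCompletionIntegers.isUnit_iff_valued_eq_one (a :=
    (⟨((α : K) : v.adicCompletion K), coe_algebraMap_mem (𝓞 K) K v α⟩ : v.adicCompletionIntegers K))).mpr
      (valued_algebraMap_eq_one_of_not_mem v hα)).unit

/-- `α_v`, as an element of `K_v`, is `α`. [cite: NeukirchANT1999, Ch. II §3 Prop. (3.8)] -/
@[simp] theorem coe_integerUnit (α : 𝓞 K) (hα : α ∉ v.asIdeal) :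
    (((integerUnit v α hα : (v.adicCompletionIntegers K)ˣ) : v.adicCompletionIntegers K) :
      v.adicCompletion K) = ((α : K) : v.adicCompletion K) :=
  rfl

variable {v}

/-- For `w ≠ v` the multiplicity of `w` in `𝔪vⁿ` is that in `𝔪`. [cite: NeukirchANT1999, Ch. VI §1 Def. (1.7)] -/
theorem modulusExp_mul_pow_of_ne (h𝔪 : 𝔪 ≠ ⊥) (n : ℕ) {w : HeightOneSpectrum (𝓞 K)} (hw : w ≠ v) :
    modulusExp (𝔪 * v.asIdeal ^ n) w = modulusExp 𝔪 w := by
  have h1 : (modulusExp (𝔪 * v.asIdeal ^ n) w : ℤ) = (modulusExp 𝔪 w : ℤ) := by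
    rw [modulusExp, modulusExp, ← FractionalIdeal.count_coe K w (mul_ne_zero h𝔪 (pow_ne_zero _ v.ne_bot)),
      ← FractionalIdeal.count_coe K w h𝔪, count_mul_pow_eq h𝔪, if_neg hw, add_zero]
  exact_mod_cast h1

variable [IsTotallyComplex K]

/-- **`(α)·⟨α_v⁻¹⟩_v ≡ 1 mod 𝔪vⁿ`**: for `α ≠ 0`, `α − 1 ∈ 𝔪`, `α ∉ v`, the idele
`(α)·⟨α_v⁻¹⟩_v` (components `α` away from `v`, `1` at `v`) lies in Neukirch's `I_K^{(𝔪vⁿ)}`.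
[cite: NeukirchANT1999, Ch. VI §1 Prop. (1.9) (proof) p. 365] -/
theorem principalIdele_mul_localUnits_integerUnit_inv_mem_congruenceIdeles (h𝔪 : 𝔪 ≠ ⊥) {α : 𝓞 K} (hα0 : α ≠ 0)
    (hα𝔪 : α - 1 ∈ 𝔪) (hαv : α ∉ v.asIdeal) (n : ℕ) :
    principalIdele K (Units.mk0 (α : K) (by exact_mod_cast hα0)) *
        localUnits v (Units.map ((v.adicCompletionIntegers K).subtype : _ →* _) (integerUnit v α hαv)⁻¹) ∈
      congruenceIdeles (𝔪 * v.asIdeal ^ n) := by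
  have hα : principalIdele K (Units.mk0 (α : K) (by exact_mod_cast hα0)) ∈ congruenceIdeles 𝔪 :=
    principalIdele_mem_congruenceIdeles_iff.mpr (unitsMk0_mem_rayElements_of_sub_one_mem hα0 hα𝔪)
  rw [mem_congruenceIdeles_iff] at hα ⊢
  refine ⟨fun w hw ↦ ?_, fun w hw ↦ absurd hw
    (InfinitePlace.not_isReal_iff_isComplex.mpr (IsTotallyComplex.isComplex w))⟩
  rw [ideleGroup_val_snd_mul]
  by_cases hwv : w = v
  · subst hwv
    rw [principalIdele_snd, Units.val_mk0, localUnits_snd_apply_self]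
    have hx : ((Units.map ((w.adicCompletionIntegers K).subtype : _ →* _) (integerUnit w α hαv)⁻¹ :
        (w.adicCompletion K)ˣ) : w.adicCompletion K) = ((((integerUnit w α hαv)⁻¹ :
          (w.adicCompletionIntegers K)ˣ) : w.adicCompletionIntegers K) : w.adicCompletion K) := rfl
    have h1 : (algebraMap K (w.adicCompletion K)) (α : K) *
        ((Units.map ((w.adicCompletionIntegers K).subtype : _ →* _) (integerUnit w α hαv)⁻¹ :
          (w.adicCompletion K)ˣ) : w.adicCompletion K) = 1 := by
      rw [hx, algebraMap_adicCompletion_apply, ← coe_integerUnit w α hαv, ← MulMemClass.coe_mul,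
        ← Units.val_mul, mul_inv_cancel, Units.val_one, OneMemClass.coe_one]
    rw [h1, sub_self, map_zero]
    exact zero_le
  · rw [localUnits_snd_apply_of_ne _ hwv, mul_one, modulusExp_mul_pow_of_ne h𝔪 n hwv]
    exact hα.1 w (by rwa [modulusExp_mul_pow_of_ne h𝔪 n hwv] at hw)

/-- ★★ **`[⟨α_v⁻¹⟩_v, K]|_{K(𝔪vⁿ)} = ((α), K(𝔪vⁿ)/K)`** for `α ≠ 0`, `α − 1 ∈ 𝔪`, `α ∉ v` and every
`n`: under `G(K(𝔪vⁿ)/K) ≅ Cl^{𝔪vⁿ}` (`rayClassField_galEquivRayClassGroup`) the idele `⟨α_v⁻¹⟩_v` goes to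
the class of the ideal of `(α)·⟨α_v⁻¹⟩_v ∈ I^{(𝔪vⁿ)}` (Neukirch's «`( )`», `rayClassOfIdele_eq`), which is
`(α)` (`⟨α_v⁻¹⟩_v` is a unit idele), and the inverse isomorphism is the Artin symbol
(`rayClassField_galEquivRayClassGroup_symm_mk_eq_artinHom`). [cite: NeukirchANT1999, Ch. VI §1 Prop. (1.9), §7 Thm. (7.1)]
[cite: deShalit1987, II.1.7 (p. 41)] -/
theorem abRestrict_ideleArtinMap_localUnits_integerUnit_inv (h𝔪 : 𝔪 ≠ ⊥) (hv : ¬ 𝔪 ≤ v.asIdeal) {α : 𝓞 K} (hα0 : α ≠ 0)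
    (hα𝔪 : α - 1 ∈ 𝔪) (hαv : α ∉ v.asIdeal) (n : ℕ) :
    abRestrict (rayClassField K (𝔪 * v.asIdeal ^ n)) (ideleArtinMap K
        (localUnits v (Units.map ((v.adicCompletionIntegers K).subtype : _ →* _) (integerUnit v α hαv)⁻¹))) =
      artinHom (galFrob K (rayClassField K (𝔪 * v.asIdeal ^ n)))
        (toPrincipalIdeal (𝓞 K) K (Units.mk0 (α : K) (by exact_mod_cast hα0))) := by
  have h𝔪n : 𝔪 * v.asIdeal ^ n ≠ ⊥ := mul_ne_zero h𝔪 (pow_ne_zero _ v.ne_bot)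
  set a : Kˣ := Units.mk0 (α : K) (by exact_mod_cast hα0) with ha_def
  set x := localUnits v (Units.map ((v.adicCompletionIntegers K).subtype : _ →* _)
    (integerUnit v α hαv)⁻¹) with hx_def
  have hy := principalIdele_mul_localUnits_integerUnit_inv_mem_congruenceIdeles h𝔪 hα0 hα𝔪 hαv n
  -- the ideal of `(α)·x` is `(α)`: `x` is a unit idele
  have hxU : x ∈ unitIdeles K := rayUnitIdeles_le_unitIdeles
    (localUnits_integer_mem_rayUnitIdeles h𝔪 hv (integerUnit v α hαv)⁻¹)
  have hideal : ideleIdeal (principalIdele K a * x) = toPrincipalIdeal (𝓞 K) K a := by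
    rw [ideleIdeal_mul, ideleIdeal_principalIdele, ideleIdeal_eq_one_iff_mem_unitIdeles.mpr hxU, mul_one]
  have hmem : toPrincipalIdeal (𝓞 K) K a ∈ idealsPrimeTo (𝔪 * v.asIdeal ^ n) := by
    rw [← hideal]; exact ideleIdeal_mem_idealsPrimeTo h𝔪n hy
  -- the ray class of `x` is `[(α)]`
  have hclass : rayClassOfIdele h𝔪n x =
      (QuotientGroup.mk (⟨toPrincipalIdeal (𝓞 K) K a, hmem⟩ : idealsPrimeTo (𝔪 * v.asIdeal ^ n)) :
        RayClassGroup (𝔪 * v.asIdeal ^ n)) := by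
    rw [rayClassOfIdele_eq h𝔪n hy, congruenceIdelesRayClass_apply]
    congr 1
    exact Subtype.ext hideal
  apply (rayClassField_galEquivRayClassGroup h𝔪n).injective
  rw [rayClassField_galEquivRayClassGroup_abRestrict_ideleArtinMap, hclass,
    ← rayClassField_galEquivRayClassGroup_symm_mk_eq_artinHom h𝔪n hmem, MulEquiv.apply_symm_apply]

/-- ★★ **An Artin symbol of `(α)` has `v`-adic Artin value `α_v⁻¹`**: any `σ ∈ Γ_K` restricting to
`((α), K(𝔪vⁿ)/K)` on every layer `K(𝔪vⁿ)` satisfies `IsAdicArtinValue 𝔪 v σ α_v⁻¹`.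
[cite: deShalit1987, II.1.7 (p. 41), I.3.3 (9) (p. 18)] [cite: NeukirchANT1999, Ch. VI §7 Thm. (7.1)] -/
theorem isAdicArtinValue_integerUnit_inv_of_forall (h𝔪 : 𝔪 ≠ ⊥) (hv : ¬ 𝔪 ≤ v.asIdeal) {α : 𝓞 K} (hα0 : α ≠ 0) (hα𝔪 : α - 1 ∈ 𝔪)
    (hαv : α ∉ v.asIdeal) {σ : absoluteGaloisGroup K}
    (hσ : ∀ n : ℕ, absRestrictNormalHom (rayClassField K (𝔪 * v.asIdeal ^ n)) σ =
      artinHom (galFrob K (rayClassField K (𝔪 * v.asIdeal ^ n)))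
        (toPrincipalIdeal (𝓞 K) K (Units.mk0 (α : K) (by exact_mod_cast hα0)))) :
    IsAdicArtinValue 𝔪 v σ (integerUnit v α hαv)⁻¹ := fun n ↦ by
  rw [hσ n, abRestrict_ideleArtinMap_localUnits_integerUnit_inv h𝔪 hv hα0 hα𝔪 hαv n]

/-- Such a `σ` lies in `Gal(K̄/K(𝔪))` (the Artin symbol of `(α)`, `α ≡ 1 mod 𝔪`, is trivial on
`K(𝔪)`: `(α) ∈ P^𝔪`). [cite: NeukirchANT1999, Ch. VI §7 Thm. (7.1)] -/
theorem mem_ker_of_forall_absRestrictNormalHom_eq_artinHom (h𝔪 : 𝔪 ≠ ⊥) (hv : ¬ 𝔪 ≤ v.asIdeal) {α : 𝓞 K} (hα0 : α ≠ 0) (hα𝔪 : α - 1 ∈ 𝔪)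
    (hαv : α ∉ v.asIdeal) {σ : absoluteGaloisGroup K}
    (hσ : ∀ n : ℕ, absRestrictNormalHom (rayClassField K (𝔪 * v.asIdeal ^ n)) σ =
      artinHom (galFrob K (rayClassField K (𝔪 * v.asIdeal ^ n)))
        (toPrincipalIdeal (𝓞 K) K (Units.mk0 (α : K) (by exact_mod_cast hα0)))) :
    σ ∈ (absRestrictNormalHom (rayClassField K 𝔪)).ker := by
  have h := (isAdicArtinValue_integerUnit_inv_of_forall h𝔪 hv hα0 hα𝔪 hαv hσ).mem_ker_iff_mem_sup 0
  rw [pow_zero, mul_one] at h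
  exact h.mpr (Subgroup.mem_sup_right (localUnits_integer_mem_rayUnitIdeles h𝔪 hv _))

/-- ★★ **`κ(σ_(α)) = α_v⁻¹`** (`w_𝔪 = 1`): the `v`-adic Artin character of any Artin symbol `σ` of the
principal ideal `(α)`, `α ≡ 1 mod 𝔪`, `v ∤ α`, is `α_v⁻¹` — de Shalit's `κ(σ_𝔞)` for `𝔞 = (α)`
(his `φ(σ_𝔞) = α` up to the reciprocity sign), the division data of II.4.12 in `κ`-currency.
[cite: deShalit1987, II.1.7 (p. 41), II.4.12 (p. 66–68)] [cite: NeukirchANT1999, Ch. VI §7 Thm. (7.1)] -/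
theorem rayAdicCharacter_eq_integerUnit_inv (h𝔪 : 𝔪 ≠ ⊥) (hv : ¬ 𝔪 ≤ v.asIdeal)
    (hw : ∀ u : (𝓞 K)ˣ, (u : 𝓞 K) - 1 ∈ 𝔪 → u = 1) {α : 𝓞 K} (hα0 : α ≠ 0) (hα𝔪 : α - 1 ∈ 𝔪)
    (hαv : α ∉ v.asIdeal) {σ : absoluteGaloisGroup K}
    (hσ : ∀ n : ℕ, absRestrictNormalHom (rayClassField K (𝔪 * v.asIdeal ^ n)) σ =
      artinHom (galFrob K (rayClassField K (𝔪 * v.asIdeal ^ n)))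
        (toPrincipalIdeal (𝓞 K) K (Units.mk0 (α : K) (by exact_mod_cast hα0)))) :
    rayAdicCharacter h𝔪 hv hw ⟨σ, mem_ker_of_forall_absRestrictNormalHom_eq_artinHom h𝔪 hv hα0 hα𝔪 hαv hσ⟩ =
      (integerUnit v α hαv)⁻¹ :=
  rayAdicCharacter_eq_of_isAdicArtinValue h𝔪 hv hw
    (isAdicArtinValue_integerUnit_inv_of_forall h𝔪 hv hα0 hα𝔪 hαv hσ)

omit [IsTotallyComplex K] in
/-- **Artin symbols of an ideal exist in `Γ_K`, coherently on all ray class fields prime to it**: for an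
invertible fractional ideal `𝔞` there is `σ ∈ Γ_K` with `σ|_{C_𝔪'} = (𝔞, C_𝔪'/K)` for EVERY `𝔪' ≠ 0`
to which `𝔞` is prime — a lift of `[idealIdele 𝔞, K] ∈ Γ_K^ab`.
[cite: NeukirchANT1999, Ch. VI §7 Thm. (7.1)] -/
theorem exists_forall_absRestrictNormalHom_eq_artinHom (𝔞 : (FractionalIdeal (𝓞 K)⁰ K)ˣ) :
    ∃ σ : absoluteGaloisGroup K, ∀ 𝔪' : Ideal (𝓞 K), 𝔪' ≠ ⊥ → 𝔞 ∈ idealsPrimeTo 𝔪' →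
      absRestrictNormalHom (rayClassField K 𝔪') σ = artinHom (galFrob K (rayClassField K 𝔪')) 𝔞 := by
  obtain ⟨σ, hσ⟩ := QuotientGroup.mk'_surjective (commutator (absoluteGaloisGroup K)).topologicalClosure
    (ideleArtinMap K (idealIdele 𝔞))
  refine ⟨σ, fun 𝔪' h𝔪' h𝔞 ↦ ?_⟩
  rw [← abRestrict_absGaloisAbProj, show absGaloisAbProj K σ = ideleArtinMap K (idealIdele 𝔞) from hσ,
    abRestrict_ideleArtinMap_idealIdele_rayClassField h𝔪' h𝔞]

/-- `(α)` is prime to `𝔪vⁿ` for `α − 1 ∈ 𝔪`, `α ∉ v`. [cite: NeukirchANT1999, Ch. VI §1 Prop. (1.9)] -/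
theorem toPrincipalIdeal_mem_idealsPrimeTo_mul_pow (h𝔪 : 𝔪 ≠ ⊥) (hv : ¬ 𝔪 ≤ v.asIdeal) {α : 𝓞 K} (hα0 : α ≠ 0) (hα𝔪 : α - 1 ∈ 𝔪)
    (hαv : α ∉ v.asIdeal) (n : ℕ) :
    toPrincipalIdeal (𝓞 K) K (Units.mk0 (α : K) (by exact_mod_cast hα0)) ∈
      idealsPrimeTo (𝔪 * v.asIdeal ^ n) := by
  have hy := principalIdele_mul_localUnits_integerUnit_inv_mem_congruenceIdeles h𝔪 hα0 hα𝔪 hαv n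
  have hxU : localUnits v (Units.map ((v.adicCompletionIntegers K).subtype : _ →* _)
      (integerUnit v α hαv)⁻¹) ∈ unitIdeles K := rayUnitIdeles_le_unitIdeles
    (localUnits_integer_mem_rayUnitIdeles h𝔪 hv (integerUnit v α hαv)⁻¹)
  have hideal := ideleIdeal_mem_idealsPrimeTo (mul_ne_zero h𝔪 (pow_ne_zero _ v.ne_bot)) hy
  rwa [ideleIdeal_mul, ideleIdeal_principalIdele, ideleIdeal_eq_one_iff_mem_unitIdeles.mpr hxU,
    mul_one] at hideal

/-- **`σ_(α)` EXISTS**: for `α ≠ 0`, `α − 1 ∈ 𝔪`, `α ∉ v` there is `σ ∈ Γ_K` with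
`σ|_{K(𝔪vⁿ)} = ((α), K(𝔪vⁿ)/K)` for every `n` (and then `σ ∈ Gal(K̄/K(𝔪))`, `κσ = α_v⁻¹`).
[cite: NeukirchANT1999, Ch. VI §7 Thm. (7.1)] [cite: deShalit1987, II.4.12 (p. 66)] -/
theorem exists_forall_absRestrictNormalHom_eq_artinHom_span_singleton (h𝔪 : 𝔪 ≠ ⊥) (hv : ¬ 𝔪 ≤ v.asIdeal) {α : 𝓞 K} (hα0 : α ≠ 0)
    (hα𝔪 : α - 1 ∈ 𝔪) (hαv : α ∉ v.asIdeal) :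
    ∃ σ : absoluteGaloisGroup K, ∀ n : ℕ, absRestrictNormalHom (rayClassField K (𝔪 * v.asIdeal ^ n)) σ =
      artinHom (galFrob K (rayClassField K (𝔪 * v.asIdeal ^ n)))
        (toPrincipalIdeal (𝓞 K) K (Units.mk0 (α : K) (by exact_mod_cast hα0))) := by
  obtain ⟨σ, hσ⟩ := exists_forall_absRestrictNormalHom_eq_artinHom
    (toPrincipalIdeal (𝓞 K) K (Units.mk0 (α : K) (by exact_mod_cast hα0)))
  exact ⟨σ, fun n ↦ hσ _ (mul_ne_zero h𝔪 (pow_ne_zero _ v.ne_bot))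
    (toPrincipalIdeal_mem_idealsPrimeTo_mul_pow h𝔪 hv hα0 hα𝔪 hαv n)⟩

/-- ★★ **The level of `σ_(α)` is the `v`-adic distance of `α` to `1`**: for `α ≠ 0`, `α − 1 ∈ 𝔪`,
`α ∉ v` (`w_𝔪 = 1`): `((α), K(𝔪vⁿ)/K) = 1 ↔ α − 1 ∈ vⁿ`. So `σ_{(α)} ∈ Gal(K̄/K(𝔪vˢ)) ∖ Gal(K̄/K(𝔪v^{s+1}))`
exactly when `v(α − 1) = s` — the choice of `𝔞₁ = (α₁)` in de Shalit's II.4.12 ("`σ_{𝔞₁}` restricted to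
`Gal(K(𝔣𝔭^∞)/K(𝔣𝔭ˢ))` a topological generator"; at `p = 2`, `s ≥ 2`: the `1 + 4ℤ₂` of II.4.17).
[cite: deShalit1987, II.4.12 (p. 66–68), II.4.17 (p. 78)] [cite: NeukirchANT1999, Ch. VI §7 Thm. (7.1)] -/
theorem artinHom_toPrincipalIdeal_rayClassField_mul_pow_eq_one_iff (h𝔪 : 𝔪 ≠ ⊥) (hv : ¬ 𝔪 ≤ v.asIdeal)
    (hw : ∀ u : (𝓞 K)ˣ, (u : 𝓞 K) - 1 ∈ 𝔪 → u = 1) {α : 𝓞 K} (hα0 : α ≠ 0)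
    (hα𝔪 : α - 1 ∈ 𝔪) (hαv : α ∉ v.asIdeal) (n : ℕ) :
    artinHom (galFrob K (rayClassField K (𝔪 * v.asIdeal ^ n)))
        (toPrincipalIdeal (𝓞 K) K (Units.mk0 (α : K) (by exact_mod_cast hα0))) = 1 ↔
      α - 1 ∈ v.asIdeal ^ n := by
  rw [← abRestrict_ideleArtinMap_localUnits_integerUnit_inv h𝔪 hv hα0 hα𝔪 hαv n,
    abRestrict_ideleArtinMap_rayClassField_eq_one_iff,
    localUnits_integer_mem_sup_rayUnitIdeles_mul_pow_iff h𝔪 hv hw,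
    localUnits_integer_mem_rayUnitIdeles_mul_pow_iff h𝔪 hv, ← intValuation_le_pow_iff_mem,
    ← valuation_of_algebraMap (K := K), ← valued_algebraMap_adicCompletion v]
  -- `|α_v⁻¹ − 1| = |α − 1|` for the unit `α_v`
  have hu : Valued.v ((((integerUnit v α hαv)⁻¹ : (v.adicCompletionIntegers K)ˣ) :
      v.adicCompletionIntegers K) : v.adicCompletion K) = 1 := by
    have h := (HeightOneSpectrum.adicCompletionIntegers.integers K v).valuation_unit (integerUnit v α hαv)⁻¹
    rwa [show ∀ x : v.adicCompletionIntegers K, algebraMap (v.adicCompletionIntegers K) (v.adicCompletion K) x =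
      (x : v.adicCompletion K) from fun _ ↦ rfl] at h
  have key : Valued.v (((((integerUnit v α hαv)⁻¹ : (v.adicCompletionIntegers K)ˣ) :
      v.adicCompletionIntegers K) : v.adicCompletion K) - 1) =
      Valued.v (algebraMap K (v.adicCompletion K) (algebraMap (𝓞 K) K (α - 1))) := by
    rw [map_sub (algebraMap (𝓞 K) K), map_one, map_sub (algebraMap K (v.adicCompletion K)), map_one,
      ← NumberField.RingOfIntegers.coe_eq_algebraMap, algebraMap_adicCompletion_apply, ← coe_integerUnit v α hαv]
    have e3 : ((((integerUnit v α hαv)⁻¹ : (v.adicCompletionIntegers K)ˣ) : v.adicCompletionIntegers K) :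
        v.adicCompletion K) - 1 = ((((integerUnit v α hαv)⁻¹ : (v.adicCompletionIntegers K)ˣ) :
          v.adicCompletionIntegers K) : v.adicCompletion K) *
        (1 - (((integerUnit v α hαv : (v.adicCompletionIntegers K)ˣ) : v.adicCompletionIntegers K) :
          v.adicCompletion K)) := by
      rw [mul_sub, mul_one, ← MulMemClass.coe_mul, ← Units.val_mul, inv_mul_cancel, Units.val_one,
        OneMemClass.coe_one]
    rw [e3, map_mul, hu, one_mul, Valuation.map_sub_swap]
  rw [key]

end Principal

end Literature.NumberTheory.NumberFields

end
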